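import Mathlib
import Summits.Ventures.PercRepro2.UniversalClosures

/-! # Transport of the universal Hall statement (UH*): order isomorphisms, dummy coordinates, unit pieces
(seat mine-b, cell pub-perc-repro2; MINE-B.md §23)

Three plumbing lemmas for (UH*) = `Universal` (UniversalClosures.lean), used by the flow-≤2 theorem on
series–parallel networks (UniversalFlow2.lean):

* `universal_transport` — (UH*) is invariant under a label-preserving order isomorphism: `Universal r b` on
  `X` gives `Universal (r ∘ e.symm) (b ∘ e.symm)` on `X'` for every `e : X ≃o X'` (the assignment is conjugated
  by `e`).  Used for the re-association `(X ∧ Y₁) ∧ Y₂ ≅ X ∧ (Y₁ ∧ Y₂)` and the commutation of series products.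
* `universal_dummy` — a dummy coordinate is harmless: `Universal r b` on `X` gives (UH*) on `X × W` with the
  labels pulled back along the first projection (assign slot-wise inside each layer `w`).
* `universal_ser_unit` — the series product `X ∧ Y` with a **unit piece** `Y` (all labels `≤ 1`, the level-1
  Harris inequality on `Y`) satisfies (UH*) given the level-1 Harris inequality on `X`: the only sources are the
  `(x, y)` with `b x ≥ 1`, `β y = 1`, of demand `1`, and the pair of Harris assignments `(σ_X x, σ_Y y)` is a
  private target (red label `min (r (σ_X x)) (ρ (σ_Y y)) = 1`).  A free edge, a pinned edge, an absent edge and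
  every series–parallel term of flow `≤ 1` are unit pieces, so this subsumes `universal_ser_edge`.
  `exists_harris_map` extracts the Harris assignment `σ` (injective on `{β ≥ 1}`, `σ y ≤ y`, `ρ (σ y) ≥ 1`) from
  the level-1 Harris inequality. -/

namespace Summit.Ventures.PercRepro2.UHClosure

open Finset

/-- two slots with the same source and the same index are equal -/
lemma slotL_ext {X : Type*} [Preorder X] [Fintype X] {S : X → Prop} [DecidablePred S] {d : X → ℕ}
    (q q' : SlotL S d) (h1 : q.1.1.1 = q'.1.1.1) (h2 : q.1.2.val = q'.1.2.val) : q = q' := by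
  apply Subtype.ext; apply Prod.ext
  · exact Subtype.ext h1
  · exact Fin.ext h2

/-! ### Order isomorphisms -/

section transport

variable {X X' : Type*} [Preorder X] [Preorder X'] [Fintype X] [Fintype X']

/-- the slot of `X` behind a slot of `X'` (along `e.symm`) -/
def trSlot (e : X ≃o X') (r b : X → ℕ)
    (q : SlotL (USrc (r ∘ e.symm) (b ∘ e.symm)) (b ∘ e.symm)) : SlotL (USrc r b) b :=
  ⟨⟨⟨e.symm q.1.1.1, q.1.1.2⟩, ⟨q.1.2.val, lt_of_lt_of_le q.2 (le_of_lt (lt_boundL b _))⟩⟩, q.2⟩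

/-- **(UH*) is invariant under label-preserving order isomorphisms.** -/
theorem universal_transport (e : X ≃o X') (r b : X → ℕ) (h : Universal r b) :
    Universal (r ∘ e.symm) (b ∘ e.symm) := by
  obtain ⟨f, hf, hfs⟩ := h
  refine ⟨fun q => e (f (trSlot e r b q)), ?_, ?_⟩
  · intro q q' hqq'
    have h1 : f (trSlot e r b q) = f (trSlot e r b q') := e.injective hqq'
    have h2 := hf h1
    have hx : e.symm q.1.1.1 = e.symm q'.1.1.1 :=
      congrArg (fun s : SlotL (USrc r b) b => s.1.1.1) h2
    have hi : q.1.2.val = q'.1.2.val := congrArg (fun s : SlotL (USrc r b) b => s.1.2.val) h2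
    exact slotL_ext q q' (e.symm.injective hx) hi
  · intro q
    obtain ⟨hle, hr, hb⟩ := hfs (trSlot e r b q)
    have hs : (trSlot e r b q).1.1.1 = e.symm q.1.1.1 := rfl
    rw [hs] at hle hb
    refine ⟨?_, ?_, ?_⟩
    · have : e (f (trSlot e r b q)) ≤ e (e.symm q.1.1.1) := e.le_iff_le.2 hle
      rwa [e.apply_symm_apply] at this
    · simp only [Function.comp, e.symm_apply_apply]; exact hr
    · simp only [Function.comp, e.symm_apply_apply]; exact hb

end transport

/-! ### Dummy coordinates -/

section dummy

variable {X W : Type*} [Preorder X] [Preorder W] [Fintype X] [Fintype W]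

/-- the `X`-slot behind a slot of `X × W` with pulled-back labels -/
def dmSlot (r b : X → ℕ)
    (q : SlotL (USrc (fun p : X × W => r p.1) (fun p : X × W => b p.1)) (fun p : X × W => b p.1)) :
    SlotL (USrc r b) b :=
  ⟨⟨⟨q.1.1.1.1, q.1.1.2⟩, ⟨q.1.2.val, lt_of_lt_of_le q.2 (le_of_lt (lt_boundL b _))⟩⟩, q.2⟩

/-- **a dummy coordinate preserves (UH*)**: the labels pulled back along the first projection -/
theorem universal_dummy (r b : X → ℕ) (h : Universal r b) :
    Universal (fun p : X × W => r p.1) (fun p : X × W => b p.1) := by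
  obtain ⟨f, hf, hfs⟩ := h
  refine ⟨fun q => (f (dmSlot r b q), q.1.1.1.2), ?_, ?_⟩
  · intro q q' hqq'
    have h1 : f (dmSlot r b q) = f (dmSlot r b q') := (Prod.mk.inj hqq').1
    have hw : q.1.1.1.2 = q'.1.1.1.2 := (Prod.mk.inj hqq').2
    have h2 := hf h1
    have hx : q.1.1.1.1 = q'.1.1.1.1 := congrArg (fun s : SlotL (USrc r b) b => s.1.1.1) h2
    have hi : q.1.2.val = q'.1.2.val := congrArg (fun s : SlotL (USrc r b) b => s.1.2.val) h2
    exact slotL_ext q q' (Prod.ext hx hw) hi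
  · intro q
    obtain ⟨hle, hr, hb⟩ := hfs (dmSlot r b q)
    have hs : (dmSlot r b q).1.1.1 = q.1.1.1.1 := rfl
    rw [hs] at hle hb
    exact ⟨Prod.mk_le_mk.2 ⟨hle, le_rfl⟩, hr, hb⟩

end dummy

/-! ### Unit pieces -/

section unit

variable {X Y : Type*} [Preorder X] [Preorder Y] [Fintype X] [Fintype Y]

/-- **the level-1 Harris assignment**: from the level-1 Harris inequality, a map `σ` with `σ y ≤ y` and
`ρ (σ y) ≥ 1` for every `y` with `β y ≥ 1`, injective on those `y` -/
theorem exists_harris_map (ρ β : Y → ℕ) (h : LevelHarris ρ β) :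
    ∃ σ : Y → Y, (∀ y, 1 ≤ β y → σ y ≤ y ∧ 1 ≤ ρ (σ y)) ∧
      ∀ y y', 1 ≤ β y → 1 ≤ β y' → σ y = σ y' → y = y' := by
  classical
  obtain ⟨τ, hτ, hτs⟩ := exists_private_targets_of_lowerDom (fun y => 1 ≤ β y) (fun y => 1 ≤ ρ y)
    (fun _ => 1) (lowerDom_of_levelHarris1 ρ β h)
  have hpos : ∀ y : Y, 0 < boundL (fun _ : Y => (1 : ℕ)) := fun y => by
    exact lt_of_le_of_lt (Nat.zero_le _) (lt_boundL (fun _ : Y => (1 : ℕ)) y)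
  let mk : ∀ y : Y, 1 ≤ β y → SlotL (fun y => 1 ≤ β y) (fun _ => 1) := fun y hy =>
    ⟨⟨⟨y, hy, le_rfl⟩, ⟨0, hpos y⟩⟩, Nat.one_pos⟩
  refine ⟨fun y => if hy : 1 ≤ β y then τ (mk y hy) else y, ?_, ?_⟩
  · intro y hy
    simp only [dif_pos hy]
    exact hτs (mk y hy)
  · intro y y' hy hy' he
    simp only [dif_pos hy, dif_pos hy'] at he
    have := hτ he
    exact congrArg (fun s : SlotL (fun y => 1 ≤ β y) (fun _ => 1) => s.1.1.1) this

omit [Preorder X] [Preorder Y] [Fintype X] [Fintype Y] in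
/-- a source of `X ∧ Y` with a unit piece `Y`: `b x ≥ 1` and `β y = 1` -/
lemma src_unit (r b : X → ℕ) (ρ β : Y → ℕ) (hβ : ∀ y, β y ≤ 1) {p : X × Y}
    (h : USrc (fun p : X × Y => min (r p.1) (ρ p.2)) (fun p : X × Y => min (b p.1) (β p.2)) p) :
    1 ≤ b p.1 ∧ β p.2 = 1 := by
  obtain ⟨_, h2⟩ := h
  have := hβ p.2
  have h2' : 1 ≤ min (b p.1) (β p.2) := h2
  omega

/-- **(UH*) for `X` in series with a unit piece**: `Y` with all labels `≤ 1` and the level-1 Harris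
inequality, `X` with the level-1 Harris inequality. -/
theorem universal_ser_unit (r b : X → ℕ) (ρ β : Y → ℕ) (hρ : ∀ y, ρ y ≤ 1) (hβ : ∀ y, β y ≤ 1)
    (hX : LevelHarris r b) (hY : LevelHarris ρ β) :
    Universal (fun p : X × Y => min (r p.1) (ρ p.2)) (fun p : X × Y => min (b p.1) (β p.2)) := by
  obtain ⟨σX, hσX, hσXi⟩ := exists_harris_map r b hX
  obtain ⟨σY, hσY, hσYi⟩ := exists_harris_map ρ β hY
  refine ⟨fun q => (σX q.1.1.1.1, σY q.1.1.1.2), ?_, ?_⟩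
  · intro q q' hqq'
    obtain ⟨hb, hβ1⟩ := src_unit r b ρ β hβ q.1.1.2.1
    obtain ⟨hb', hβ1'⟩ := src_unit r b ρ β hβ q'.1.1.2.1
    have hx : q.1.1.1.1 = q'.1.1.1.1 := hσXi _ _ hb hb' (Prod.mk.inj hqq').1
    have hy : q.1.1.1.2 = q'.1.1.1.2 := hσYi _ _ (by omega) (by omega) (Prod.mk.inj hqq').2
    have hi : q.1.2.val = 0 := by
      have : q.1.2.val < min (b q.1.1.1.1) (β q.1.1.1.2) := q.2
      omega
    have hi' : q'.1.2.val = 0 := by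
      have : q'.1.2.val < min (b q'.1.1.1.1) (β q'.1.1.1.2) := q'.2
      omega
    exact slotL_ext q q' (Prod.ext hx hy) (by rw [hi, hi'])
  · intro q
    obtain ⟨hb, hβ1⟩ := src_unit r b ρ β hβ q.1.1.2.1
    obtain ⟨hleX, hrX⟩ := hσX _ hb
    obtain ⟨hleY, hrY⟩ := hσY q.1.1.1.2 (by omega)
    have hρ1 := hρ (σY q.1.1.1.2)
    refine ⟨Prod.mk_le_mk.2 ⟨hleX, hleY⟩, ?_, ?_⟩
    · show min (r (σX q.1.1.1.1)) (ρ (σY q.1.1.1.2)) = 1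
      omega
    · show min (b q.1.1.1.1) (β q.1.1.1.2) ≤ min (b (σX q.1.1.1.1)) (β (σY q.1.1.1.2)) + 1
      omega

end unit

end Summit.Ventures.PercRepro2.UHClosure
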